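/-
Copyright: statement-level skeleton of a published paper (lit-balaban cell, Phase-2 proof seat p27, gen 33). No proof claims
beyond what the kernel checks below.
-/
import Mathlib
import Literature.MathematicalPhysics.QuantumFieldTheory.BalabanImbrieJaffe1984to88.BIJ85Eq7113LagrangeFibre
import Literature.MathematicalPhysics.QuantumFieldTheory.BalabanImbrieJaffe1984to88.BIJ85Eq7113AxisFibres
import Literature.MathematicalPhysics.QuantumFieldTheory.BalabanImbrieJaffe1984to88.BIJ85Eq7118Intertwining

/-!
# `BalabanImbrieJaffe1984to88.BIJ85SigmaAllN` — T. Bałaban, J. Imbrie, A. Jaffe, *Renormalization of the Higgs model: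
minimizers, propagators and the stability of mean field theory*, Commun. Math. Phys. **97** (1985) 299–329 [BalabanImbrieJaffe1985]:
Sect. 7.1 pp. 322–324, (7.1.10)–(7.1.16) — **`σ_k(p′) = τ₁(p′) + τ₂(p′)` WITH THE SYMBOLS (7.1.14)–(7.1.16) SUMMED OVER THE COMPLETE
RESIDUE SYSTEM OF SHIFTS, FOR EVERY BLOCK SIZE `n = L^k` — EVEN `n` INCLUDED — AT EVERY UNIT MOMENTUM `p′`**.
Print sums the l-terms of (7.1.10), (7.1.11), (7.1.14), (7.1.16) over *"l ∈ 2πZ^d, |l_i| ≤ π/η"* (p. 322, (7.1.10)), one representative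
per fine momentum `p = p′ + l` of the fibre of `p′`; the fibre of `p′` on the η-lattice, `η = 1/n`, is the complete residue system
`{p′ + 2πk : k ∈ (ℤ/n)^d}` — r15's symmetric window `|m_i| ≤ M` realises it for odd `n = 2M + 1` only, whereas pub-balaban's offsets
`k : Fin d → Fin n` (`B4Strip.shiftr`, [6I] = Bałaban CMP 95 (1.31)) realise it for EVERY `n`.  Here the closed-cube l-terms of seat
p10 (`BIJ85SigmaClosedCube.t1C`, `aTermC`, the (7.1.10) term, gen-2 `tau2Kernel`) are summed over `k : Fin d → Fin n`:
`τ₁^A_n(p′)` ((7.1.14)), `a^A_n(p′)` ((7.1.16)), `φ^A_n(p′)` ((7.1.10)), `τ₂^A_n(p′)` ((7.1.15)), `σ^A_n = τ₁^A_n + τ₂^A_n` ((7.1.13)), and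
the identification with seat p27's configuration-space fibre problem `BIJ85Eq7112FibreEnergy` (defined for every `n`) is PROVED
for every `n ≥ 1`, every torus `N`, EVERY `q : Tor N` (axes and `q = 0` included) and every two-form `φ`:
**`fibreMinU n N q φ = 2·Re⟨φ, τ₁^A_n(p′)φ⟩`** and **`fibreMin n N q φ = 2·Re⟨φ, σ^A_n(p′)φ⟩`** (`p′ = sOf N q`) — by the Lagrange
computation of file `BIJ85Eq7113LagrangeFibre` at `p′ ≠ 0` and directly at `p′ = 0` (where `∂(0) = 0` at the zero shift frees the
constraint: `τ₂^A_n(0) = 0`); hence `0 ≤ τ₂^A` as a form, the closed-cube symbols of gen 31 are the case `n = 2M + 1` AS FORMS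
(`sigmaA_form_eq_sigmaC_form`), and for the σ_k/τ₁/τ₂ OF RECORD the three identification theorems hold with `n = L^k` and NO parity
hypothesis in the statement (`symb_sigmaMatrix_form_eq_sigmaA`, `symb_tau1Matrix_form_eq_tau1A`, `symb_tau2Matrix_form_eq_tau2A`).

statement-level skeleton of published theorems with citation tags; proofs where landed; nothing here is a claim about
the Yang–Mills mass gap

PDF held: `paper:balaban1985-cmp97-bij-higgs-minimizers` (journal page = PDF page + 298); pp. 322–324 [PDF 24–26] re-read as images
(`run/shared/lean/pub/pub-balaban/t4/b2b-balaban-t4-lit2/renders/bij1985/1985-cmp97-bij-higgs-minimizers-p024-x2.png` …).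

THE PRINTED TEXT (verbatim, pp. 322–323).  p. 322: *"φ_μ(p′) = Σ_{l∈2πZ^d, |l_i|≤π/η} |u(p′+l)v_μ(p′+l)|²Δ(p′+l)^{−1}. (7.1.10)"*; *"We express
σ_k as a sum of two terms σ_k = τ₁ + τ₂. (7.1.13) Here τ₁ vanishes on curls. Thus if f = ∂B, then τ₁f = 0. Explicitly
τ_{1,μνλκ}(p′) = ½Σ_l(|u|²/(v̄_μv̄_νv_λv_κ)[δ_{μλ} − ∂_μ∂̄_λ/Δ][δ_{νκ} − ∂_ν∂̄_κ/Δ])(p′+l), (7.1.14)"*; p. 323: *"and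
τ_{2,μνλκ}(p′) = (a_μā_λ(φ_νφ_κ)^{−1/2}[δ_{νκ} − (∂^{(1)}_ν\overline{∂^{(1)}_κ}/√(φ_νφ_κ))(Σ_ρ|∂^{(1)}_ρ|²/φ_ρ)^{−1}])(p′). (7.1.15) In the formula for
τ₁(p′), each term on the right side is evaluated at momentum p′ + l. In the formula for τ₂, the averaging only occurs in
a_μ(p′) = ∂^{(1)}_μ(p′)Σ_l(|u/v_μ|²(1/Δ))(p′+l). (7.1.16)"*.
THE l-RANGE IN [6I] (the source print cites for these symbols, p. 322 *"[6I, Eqs. (1.83) and (1.84)]"*; Bałaban, CMP **95** (1984)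
p. 23, after (1.31), verbatim): *"p ∈ T̃_η is represented as a sum p = p′ + l, p′ ∈ T̃₁^{(k)} and l = (l₁, …, l_d), l_μ = 2πm_μ, m_μ is an
integer, −(L^k − 1)/2 ≤ m_μ ≤ (L^k − 1)/2 for L odd, −L^k/2 ≤ m_μ < L^k/2 for L even."* [cite: Balaban1984PropagatorsI, (1.31) p.23]
— a complete residue system of `m mod L^k` for EITHER parity (render `pub-balaban/b2b-balaban-ref1/pages/1984-cmp95-propagators-rt-I/…-p007-x2.png`).
READING (ours).  The l-sums are taken over the complete residue system `l = 2πk`, `k : Fin d → Fin n` (`m_μ mod n ∈ {0, …, n−1}`), of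
the fibre of `p′` — [6I]'s convention up to the choice of representatives (every summand is 2πn-periodic in each `l_μ`, so any
residue system gives the same sum; BIJ's `|l_i| ≤ π/η` in (7.1.10) names the symmetric one, a residue system exactly when `n` is odd); the quotients `v_μ`, `u/v`, `|u/v_μ|²` are p10's division-free
closed-cube forms (`vC` = the geometric sum, `qeW = Π_{ρ∉{μ,ν}}v_ρ`, `aTermC = Π_{ρ≠μ}|v_ρ|²·Δ⁻¹`), i.e. the printed expressions with
their removable singularities filled (GAPS G-C1-03); the (7.1.11) weight carries the tree's base-point phase (G-C1-p27-01), which is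
ONE unimodular number per shift (`conj_edgeW_eq`) and drops out of every form.

CITATION HEADER (lean-in-tree rule).  Part of the lit-balaban TYPED SKELETON (HOME `run/shared/lean/pub/lit-balaban/`), Phase-2 seat p27
(gen 33), unit `lit-balaban-p27`; rows **C1.Eq7.1.13-7.1.19**, **C1.Eq7.1.2-7.1.12** (fold owner r15, referee ref-5); r15's `C1-CLOSURE.md`
v1.5 §5 item 6 = lead g10's Q2 flip trigger (HOME/INBOX 2026-08-22T21:19:00Z): *"it flips when a parity-free (or even-L) version of the
σ_k = τ₁ + τ₂ identification and (7.1.14)–(7.1.18) lands"*.  INPUTS (landed, by name): file `BIJ85Eq7113LagrangeFibre` (this gen: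
`energyL_split`, `tOne_le_energyL`, `energyL_hodge`, `constrL_alphaStar`, `energyL_alphaStar`, `lower_bound`); p27's
`BIJ85Eq7112FibreEnergy`/`…FibreMin`/`BIJ85Eq7117FibreMinFree` (`fibreEnergy`, `FibreConstraint`, `fibreMin`, `fibreMinU` and their
inf-API), `BIJ85Eq7111EdgeAverage` (`edgeW`, `edgeW_eq`, `edgeW_mul_conj_vSym`, `om_pow_mul_conj_vSym`, `conj_om`, `norm_om`),
`BIJ85Eq7118Intertwining` (`edgeW_comm`); pub-balaban's `Balaban1983to89.B5Prop11Fiber` (`dSym`, `d1Sym`, `vSym`, `uSym`,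
`d1Sym_eq_vSym_mul`, `dSym_eq_zero_iff`, `norm_d1Sym_sq`), `B4Strip` (`shiftr`, `Sxir_pos`), `B5Prop11Plancherel` (`Tor`, `sOf`,
`abs_sOf_le`); p10's `BIJ85SigmaClosedCube` (`vC`, `uC`, `qeW`, `t1C`, `aTermC`, `gW`, `sigmaC`, `tau1C`, `tau2C`),
`BIJ85SigmaClosedCubeZero` (`tensorInner_t1C_eq`, `vC_eq_6I`, `uC_eq_6I`), `BIJ85MomentumSymbols6I` (`dSym_eq_6I`); gen-2
`BIJ85Tau2Kernel715` (`tau2Kernel`, `hVec`, `enn`, `scl`, `tensorInner_tau2Kernel`, `tensorInner_tau2Kernel_eq_normSq`); gen 6/31 of this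
seat (`symb_sigmaMatrix_form_eq_half_fibreMin`, `symb_tau1Matrix_form_eq_half_fibreMinU`, `symb_tau2Matrix_form_eq_half_sub`,
`fibreMin_eq_two_mul_sigmaC_form`, `fibreMinU_eq_two_mul_tau1C_form`).
WHAT IS KERNEL-CHECKED (zero `sorry`, standard axioms; file 1 of 2 — the constrained identification `σ^A = τ₁^A + τ₂^A`, the
record corollaries and the consistency with the closed cube are file 2 `BIJ85Eq7113AllN`): §1 the all-n symbols `tau1A`, `aA`, `phiA`,
`tau2A`, `sigmaA` and the fibre data `eA`/`rA`/`gA` (definitions with bodies); §2 the dictionary (`fibreEnergy_eq_energyL`,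
`fibreConstraint_iff_constrL`, `gA_twoForm`, **`conj_edgeW_eq`** (one unimodular phase per shift), `tensorInner_tau1A`,
**`tOne_eq_two_mul_tau1A_form`**); §3 **`fibreMinU_eq_two_mul_tau1A_form`** — `m°_{p′}(φ) = 2·Re⟨φ, τ₁^A_n(p′)φ⟩` for EVERY `n ≥ 1`
and EVERY `q : Tor N`; `curlA`, `gA_curlA_eq`/`tOne_curlA`/**`tau1A_form_curlA`** ((7.1.18) *"τ₁∂ = 0"*: τ₁^A_n vanishes on the fibre of every
unit-lattice curl, every `n` — via p27 gen 2's `BIJ85Eq7118Intertwining.key_identity`); §4 the zero fibre: `eA_zero_zero` (`∂(0) = 0`), `rA_zero_zero` (`u(0)v(0) = 1`),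
**`fibreMin_eq_fibreMinU_of_sOf_eq_zero`** (the constraint is free at `p′ = 0`), **`tau2A_form_zero`** (`⟨φ, τ₂^A_n(0)φ⟩ = 0`).
HONEST SCOPE: the carrier is the configuration-space fibre problem on
the tori `Π_μ ℤ/(nN_μ)` for every `n` (p27's `fibreMin`, the object behind `symb sigmaMatrix` by gen 6); the σ_k OF RECORD still lives on
`Setup` tori (`Params.hL`: `L` odd) — what is parity-free is the identification theorem and the symbols, stated and proved for all `n`.
-/

namespace Literature.MathematicalPhysics.QuantumFieldTheory.BalabanImbrieJaffe1984to88.BIJ85SigmaAllN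

open scoped BigOperators Matrix ComplexConjugate Kronecker
open Literature.MathematicalPhysics.QuantumFieldTheory.Balaban1983to89
open B5Prop11Plancherel (Tor sOf abs_sOf_le sOf_zero)
open B5Eq117TorusCarriers (Mk)
open B4Strip (shiftr)
open BIJ85MomentumSymbols71 (tensorInner dSym dOne lapSym)
open BIJ85CurlComplement719 (IsTwoForm projK)
open BIJ85Tau2Kernel715 (tau2Kernel hVec enn scl tensorInner_tau2Kernel tensorInner_tau2Kernel_eq_normSq)
open BIJ85SigmaClosedCube (vC uC qeW t1C aTermC gW tau1C tau2C sigmaC)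
open BIJ85SigmaClosedCubeZero (tensorInner_t1C_eq vC_eq_6I uC_eq_6I)
open BIJ85MomentumSymbols6I (dSym_eq_6I)
open BIJ85Eq7111EdgeAverage (edgeW edgeW_eq edgeW_mul_conj_vSym om_pow_mul_conj_vSym conj_om norm_om)
open BIJ85Eq7118Intertwining (edgeW_comm)
open BIJ85Eq7112FibreEnergy (fibreEnergy FibreConstraint)
open BIJ85Eq7112FibreMin (fibreMin fibreMin_le le_fibreMin_iff)
open BIJ85Eq7117FibreMinFree (fibreMinU fibreMinU_le le_fibreMinU_iff fibreMinU_le_fibreMin)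
open BIJ85Eq7113LagrangeFibre (lap energyL ConstrL tOne hodgeB cv phiL wv lamb val alphaStar energyL_split tOne_le_energyL
  energyL_hodge constrL_alphaStar energyL_alphaStar lower_bound)
open BIJ85Eq712Plancherel (symb)
open BIJ85Sigma712Torus (Orient torN sigmaMatrix)
open BIJ85Eq7112SymbolFibreMin (asymO symb_sigmaMatrix_form_eq_half_fibreMin)
open BIJ85Eq7113SymbolIdentification (asymO_swap)
open BIJ85Eq7117Tau1Symbol (tau1Matrix tau2Matrix symb_tau1Matrix_form_eq_half_fibreMinU)
open BIJ85Eq7114Tau1Identification (symb_tau2Matrix_form_eq_half_sub)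
open BIJ85Eq7113AxisFibres (fibreMin_eq_two_mul_sigmaC_form)
open BIJ85Tau1ClosedCube (fibreMinU_eq_two_mul_tau1C_form)
open BIJ85Sigma421Torus

noncomputable section

variable {d : ℕ}

/-! ## §1 The symbols (7.1.14)–(7.1.16) summed over the complete residue system `l = 2πk`, `k : Fin d → Fin n` -/

section Defs

variable (n : ℕ) (s : Fin d → ℝ)

/-- **(7.1.14) over the complete residue system**: `τ₁^A_n(p′) = ½Σ_{k : Fin d → Fin n} (l-term)(p′ + 2πk)`, the l-term = p10's
closed-cube `t1C` (*"|u|²/(v̄_μv̄_νv_λv_κ)[δ_{μλ} − ∂_μ∂̄_λ/Δ][δ_{νκ} − ∂_ν∂̄_κ/Δ]"* with `v` continued through its removable singularity).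
[cite: BalabanImbrieJaffe1985, (7.1.14) p.322] -/
def tau1A : Fin d → Fin d → Fin d → Fin d → ℂ :=
  fun μ ν l κ => (1 / 2 : ℂ) * ∑ k : Fin d → Fin n, t1C n (shiftr n k s) μ ν l κ

/-- **(7.1.16) over the complete residue system**: `a^A_μ(p′) = ∂^{(1)}_μ(p′)·Σ_k (|u/v_μ|²Δ^{−1})(p′ + 2πk)` (l-term = p10's `aTermC`).
[cite: BalabanImbrieJaffe1985, (7.1.16) p.323] -/
def aA (μ : Fin d) : ℂ := dOne s μ * ((∑ k : Fin d → Fin n, aTermC n (shiftr n k s) μ : ℝ) : ℂ)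

/-- **(7.1.10) over the complete residue system**: `φ^A_μ(p′) = Σ_k |u(p′+2πk)v_μ(p′+2πk)|²Δ(p′+2πk)^{−1}`.
[cite: BalabanImbrieJaffe1985, (7.1.10) p.322] -/
def phiA (μ : Fin d) : ℝ :=
  ∑ k : Fin d → Fin n, ‖uC n (shiftr n k s) * vC n (shiftr n k s) μ‖ ^ 2 * (lapSym ((n : ℝ)⁻¹) (shiftr n k s))⁻¹

/-- **(7.1.15) over the complete residue system**: `τ₂^A_n(p′) =` the printed kernel (gen-2 `tau2Kernel`) at `a^A(p′)`, `∂^{(1)}(p′)`,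
`φ^A(p′)`. [cite: BalabanImbrieJaffe1985, (7.1.15) p.323] -/
def tau2A : Fin d → Fin d → Fin d → Fin d → ℂ := tau2Kernel (aA n s) (dOne s) (phiA n s)

/-- **(7.1.13) over the complete residue system**: `σ^A_n(p′) = τ₁^A_n(p′) + τ₂^A_n(p′)`. [cite: BalabanImbrieJaffe1985, (7.1.13) p.322] -/
def sigmaA : Fin d → Fin d → Fin d → Fin d → ℂ := fun μ ν l κ => tau1A n s μ ν l κ + tau2A n s μ ν l κ

/-- The derivative vectors `∂(p′ + 2πk)` of the fibre ((7.1.4) = [6I] (1.31), `B5Prop11Fiber.dSym`), as the data `e` of file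
`BIJ85Eq7113LagrangeFibre`. [cite: BalabanImbrieJaffe1985, (7.1.4) p.322] -/
def eA : (Fin d → Fin n) → Fin d → ℂ := fun k => B5Prop11Fiber.dSym n k s

/-- The constraint weights `r_ν(p′+2πk) = (u v_ν)(p′+2πk)` of `Q_kA = 0` ([6I] (1.61), `B5Prop11Fiber.uSym/vSym`), as the data `r`.
[cite: BalabanImbrieJaffe1985, (4.2.1) p.310] -/
def rA : (Fin d → Fin n) → Fin d → ℂ := fun k μ => B5Prop11Fiber.uSym n k s * B5Prop11Fiber.vSym n k s μ

variable [NeZero n]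

/-- The two-forms `(Q^{e*}_kφ)(p′+2πk) = w̄(p′+2πk) ⊙ φ` of the fibre ((7.1.11) weight `edgeW`), as the data `G`.
[cite: BalabanImbrieJaffe1985, (7.1.11) p.322] -/
def gA (φ : Fin d × Fin d → ℂ) : (Fin d → Fin n) → Fin d → Fin d → ℂ := fun k l κ => conj (edgeW n k s l κ) * φ (l, κ)

end Defs

/-! ## §2 The dictionary: p27's fibre problem is the Lagrange file's problem for these data; the phase of the edge weight -/

section Dictionary

variable (n : ℕ) [NeZero n] {N : Fin d → ℕ} [∀ μ, NeZero (N μ)]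

omit [∀ μ, NeZero (N μ)] in
/-- `fibreEnergy n N q α φ = E(α)` of the Lagrange file for the data `(∂, Q^{e*}φ)` of the fibre. [cite: BalabanImbrieJaffe1985, (7.1.12) p.322] -/
theorem fibreEnergy_eq_energyL (q : Tor N) (α : (Fin d → Fin n) → Fin d → ℂ) (φ : Fin d × Fin d → ℂ) :
    fibreEnergy n N q α φ = energyL (eA n (sOf N q)) (gA n (sOf N q) φ) α := by
  unfold fibreEnergy energyL eA gA
  exact Finset.sum_congr rfl fun k _ => by rw [Fintype.sum_prod_type]

omit [NeZero n] [∀ μ, NeZero (N μ)] in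
/-- `Q_kA = 0` at the fibre is the Lagrange file's constraint for the weights `r = u·v`. [cite: BalabanImbrieJaffe1985, (4.2.1) p.310] -/
theorem fibreConstraint_iff_constrL (q : Tor N) (α : (Fin d → Fin n) → Fin d → ℂ) :
    FibreConstraint n N q α ↔ ConstrL (rA n (sOf N q)) α := Iff.rfl

/-- `Q^{e*}_kφ` is a two-form shift by shift when `φ` is (the weight is symmetric, `edgeW_comm`). [cite: BalabanImbrieJaffe1985, (7.1.11) p.322] -/
theorem gA_twoForm (s : Fin d → ℝ) {φ : Fin d × Fin d → ℂ} (hφ : ∀ μ ν, φ (ν, μ) = -φ (μ, ν)) (k : Fin d → Fin n) :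
    IsTwoForm (gA n s φ k) := by
  intro μ ν
  show conj (edgeW n k s ν μ) * φ (ν, μ) = -(conj (edgeW n k s μ ν) * φ (μ, ν))
  rw [edgeW_comm n k s ν μ, hφ μ ν, mul_neg]

/-- kernel: the fine derivative vector of the fibre is r15's `∂(p′ + 2πk)` at `η = 1/n`. [cite: BalabanImbrieJaffe1985, (7.1.4) p.322] -/
theorem dSym_shiftr_eq_eA (s : Fin d → ℝ) (k : Fin d → Fin n) : dSym ((n : ℝ)⁻¹) (shiftr n k s) = eA n s k := by
  funext μ
  rw [← one_div]
  exact dSym_eq_6I (NeZero.ne n) k s μ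

/-- kernel: `Δ(p′ + 2πk)` is the Lagrange file's `lap`. [cite: BalabanImbrieJaffe1985, (7.1.6) p.322] -/
theorem lapSym_shiftr_eq_lap (s : Fin d → ℝ) (k : Fin d → Fin n) : lapSym ((n : ℝ)⁻¹) (shiftr n k s) = lap (eA n s) k := by
  rw [lapSym, lap, dSym_shiftr_eq_eA]

/-- kernel: `∂^{(1)}` of r15 (`dOne`) is [6I]'s `d1Sym`. [cite: BalabanImbrieJaffe1985, (7.1.5) p.322] -/
theorem dOne_eq_d1Sym (s : Fin d → ℝ) (μ : Fin d) : dOne s μ = B5Prop11Fiber.d1Sym s μ := by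
  rw [dOne, B5Prop11Fiber.d1Sym, mul_comm]

omit [∀ μ, NeZero (N μ)] in
/-- kernel: the averaging symbol is real up to the half-block phase: `conj v_ρ = ω̄_ρ^{n−1}·v_ρ`. [cite: BalabanImbrieJaffe1985, (7.1.11) p.322] -/
theorem conj_vSym_eq (k : Fin d → Fin n) (q : Tor N) (ρ : Fin d) :
    conj (B5Prop11Fiber.vSym n k (sOf N q) ρ) =
      conj (B5Block118.om n k (sOf N q) ρ) ^ (n - 1) * B5Prop11Fiber.vSym n k (sOf N q) ρ := by
  have h := om_pow_mul_conj_vSym n N k q ρ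
  have hω0 : B5Block118.om n k (sOf N q) ρ ≠ 0 := fun h0 => by
    have := norm_om n k (sOf N q) ρ
    rw [h0, norm_zero] at this
    exact zero_ne_one this
  have hω : conj (B5Block118.om n k (sOf N q) ρ) ^ (n - 1) * B5Block118.om n k (sOf N q) ρ ^ (n - 1) = 1 := by
    rw [← mul_pow, conj_om, inv_mul_cancel₀ hω0, one_pow]
  calc conj (B5Prop11Fiber.vSym n k (sOf N q) ρ)
      = (conj (B5Block118.om n k (sOf N q) ρ) ^ (n - 1) * B5Block118.om n k (sOf N q) ρ ^ (n - 1)) *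
          conj (B5Prop11Fiber.vSym n k (sOf N q) ρ) := by rw [hω, one_mul]
    _ = conj (B5Block118.om n k (sOf N q) ρ) ^ (n - 1) *
          (B5Block118.om n k (sOf N q) ρ ^ (n - 1) * conj (B5Prop11Fiber.vSym n k (sOf N q) ρ)) := by ring
    _ = _ := by rw [h]

omit [∀ μ, NeZero (N μ)] in
/-- **The conjugate (7.1.11) weight is p10's Q^e-weight `Π_{ρ∉{μ,ν}}v_ρ` up to ONE unimodular phase per shift**: for `μ ≠ ν`,
`conj w_{μν}(p′+2πk) = c̄_k·(Π_{ρ∉{μ,ν}}v_ρ)(p′+2πk)` with `c̄_k = Π_ρ ω̄_ρ^{n−1}` independent of `(μ, ν)` — the base-point phase of the tree's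
labelling (GAPS G-C1-p27-01) drops out of every form. [cite: BalabanImbrieJaffe1985, (7.1.11) p.322] -/
theorem conj_edgeW_eq (k : Fin d → Fin n) (q : Tor N) {μ ν : Fin d} (hμν : μ ≠ ν) :
    conj (edgeW n k (sOf N q) μ ν) =
      (∏ ρ, conj (B5Block118.om n k (sOf N q) ρ) ^ (n - 1)) * qeW n (shiftr n k (sOf N q)) μ ν := by
  have hν : ν ∈ Finset.univ.erase μ := Finset.mem_erase.mpr ⟨hμν.symm, Finset.mem_univ ν⟩
  have hq : qeW n (shiftr n k (sOf N q)) μ ν = ∏ ρ ∈ (Finset.univ.erase μ).erase ν, B5Prop11Fiber.vSym n k (sOf N q) ρ :=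
    Finset.prod_congr rfl fun ρ _ => vC_eq_6I (NeZero.ne n) k (sOf N q) ρ
  rw [edgeW_eq n N k q hμν, map_mul, map_mul, map_pow, map_pow, map_prod, hq]
  simp_rw [conj_vSym_eq n k q]
  rw [Finset.prod_mul_distrib,
    ← Finset.mul_prod_erase Finset.univ (fun ρ => conj (B5Block118.om n k (sOf N q) ρ) ^ (n - 1)) (Finset.mem_univ μ),
    ← Finset.mul_prod_erase (Finset.univ.erase μ) (fun ρ => conj (B5Block118.om n k (sOf N q) ρ) ^ (n - 1)) hν]
  ring

omit [NeZero n] in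
/-- The shift-wise phase is unimodular. [cite: BalabanImbrieJaffe1985, (7.1.11) p.322] -/
theorem norm_phaseA (k : Fin d → Fin n) (s : Fin d → ℝ) : ‖∏ ρ, conj (B5Block118.om n k s ρ) ^ (n - 1)‖ = 1 := by
  rw [norm_prod]
  refine Finset.prod_eq_one fun ρ _ => ?_
  rw [norm_pow, Complex.norm_conj, norm_om, one_pow]

/-- kernel: `tensorInner` is additive in the kernel over a finite sum. [folklore] -/
private theorem tensorInner_sum {ι : Type*} (S : Finset ι) (K : ι → Fin d → Fin d → Fin d → Fin d → ℂ)
    (f : Fin d → Fin d → ℂ) :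
    tensorInner f (fun μ ν l κ => ∑ i ∈ S, K i μ ν l κ) f = ∑ i ∈ S, tensorInner f (K i) f := by
  classical
  induction S using Finset.induction_on with
  | empty => simp [tensorInner]
  | @insert a S ha ih =>
    unfold tensorInner at ih ⊢
    simp only [Finset.sum_insert ha, mul_add, add_mul, Finset.sum_add_distrib, ih]

/-- kernel: `tensorInner` is homogeneous in the kernel. [folklore] -/
private theorem tensorInner_const_mul (c : ℂ) (K : Fin d → Fin d → Fin d → Fin d → ℂ) (f : Fin d → Fin d → ℂ) :
    tensorInner f (fun μ ν l κ => c * K μ ν l κ) f = c * tensorInner f K f := by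
  unfold tensorInner
  simp only [Finset.mul_sum]
  exact Finset.sum_congr rfl fun μ _ => Finset.sum_congr rfl fun ν _ => Finset.sum_congr rfl fun l _ =>
    Finset.sum_congr rfl fun κ _ => by ring

omit [NeZero n] in
/-- `⟨f, τ₁^A_n(p′)f⟩ = ½Σ_k ⟨f, (l-term)(p′ + 2πk)f⟩`. [cite: BalabanImbrieJaffe1985, (7.1.14) p.322] -/
theorem tensorInner_tau1A (s : Fin d → ℝ) (f : Fin d → Fin d → ℂ) :
    tensorInner f (tau1A n s) f = (1 / 2 : ℂ) * ∑ k : Fin d → Fin n, tensorInner f (t1C n (shiftr n k s)) f := by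
  rw [← tensorInner_sum, ← tensorInner_const_mul]
  rfl

omit [∀ μ, NeZero (N μ)] in
/-- **`T₁ = 2·Re⟨φ, τ₁^A_n(p′)φ⟩`**: the τ₁-part of the Lagrange file for the fibre data is the form of (7.1.14) over the complete
residue system — shift by shift `‖(P⊗P)(Q^{e*}_kφ)(p′+2πk)‖² = ‖(P⊗P)((u/vv)·φ)(p′+2πk)‖²` (one unimodular phase, `conj_edgeW_eq`) =
`⟨φ, (l-term)φ⟩` (p10's `tensorInner_t1C_eq`). [cite: BalabanImbrieJaffe1985, (7.1.14) p.322] -/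
theorem tOne_eq_two_mul_tau1A_form (q : Tor N) {φ : Fin d × Fin d → ℂ} (hφ : ∀ μ ν, φ (ν, μ) = -φ (μ, ν)) :
    tOne (eA n (sOf N q)) (gA n (sOf N q) φ) =
      2 * (tensorInner (fun μ ν => φ (μ, ν)) (tau1A n (sOf N q)) (fun μ ν => φ (μ, ν))).re := by
  have h12 : (1 / 2 : ℂ) = ((1 / 2 : ℝ) : ℂ) := by norm_num
  rw [tensorInner_tau1A, h12, Complex.re_ofReal_mul, Complex.re_sum, ← mul_assoc, show (2 : ℝ) * (1 / 2) = 1 by norm_num,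
    one_mul, tOne]
  refine Finset.sum_congr rfl fun k _ => ?_
  -- the phase: (Q^{e*}φ)(p′+2πk) = c̄_k • ((u/vv)·φ)(p′+2πk)
  have hG : (fun i : Fin d × Fin d => gA n (sOf N q) φ k i.1 i.2) =
      (∏ ρ, conj (B5Block118.om n k (sOf N q) ρ) ^ (n - 1)) •
        fun i : Fin d × Fin d => gW n (shiftr n k (sOf N q)) (fun μ ν => φ (μ, ν)) i.1 i.2 := by
    funext i
    simp only [Pi.smul_apply, smul_eq_mul, gA, gW]
    by_cases hi : i.1 = i.2
    · have h0 : φ (i.1, i.2) = 0 := by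
        have h1 := hφ i.1 i.1
        rw [← hi]
        linear_combination (1 / 2 : ℂ) * h1
      simp only [h0, mul_zero]
    · rw [conj_edgeW_eq n k q hi, mul_assoc]
  rw [hG, Matrix.mulVec_smul, tensorInner_t1C_eq, Complex.ofReal_re, dSym_shiftr_eq_eA]
  refine Finset.sum_congr rfl fun i _ => ?_
  rw [Pi.smul_apply, smul_eq_mul, norm_mul, norm_phaseA, one_mul]

end Dictionary

/-! ## §3 The unconstrained fibre minimum: `m°_{p′}(φ) = 2·Re⟨φ, τ₁^A_n(p′)φ⟩` for EVERY `n` and EVERY `p′` -/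

section Free

variable (n : ℕ) [NeZero n] {N : Fin d → ℕ} [∀ μ, NeZero (N μ)]

omit [∀ μ, NeZero (N μ)] in
/-- `m°_{p′}(φ) = T₁` of the Lagrange file. [cite: BalabanImbrieJaffe1985, (7.1.17) p.323] -/
theorem fibreMinU_eq_tOne (q : Tor N) {φ : Fin d × Fin d → ℂ} (hφ : ∀ μ ν, φ (ν, μ) = -φ (μ, ν)) :
    fibreMinU n N q φ = tOne (eA n (sOf N q)) (gA n (sOf N q) φ) := by
  have hG := gA_twoForm n (sOf N q) hφ
  refine le_antisymm ?_ ((le_fibreMinU_iff n N).2 fun α => ?_)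
  · have h := fibreMinU_le n N q (fun k => hodgeB (eA n (sOf N q) k) (gA n (sOf N q) φ k)) φ
    rwa [fibreEnergy_eq_energyL, energyL_hodge _ hG] at h
  · rw [fibreEnergy_eq_energyL]
    exact tOne_le_energyL _ hG α

omit [∀ μ, NeZero (N μ)] in
/-- **`fibreMinU n N q φ = 2·Re⟨φ, τ₁^A_n(p′)φ⟩` FOR EVERY BLOCK SIZE `n ≥ 1` AND EVERY DUAL MOMENTUM `q`** (two-forms `φ`; `p′ = sOf N q`):
the unconstrained minimum of `‖∂A − Q^{e*}_kf‖²` on the fibre is the (7.1.14)-form over the complete residue system — the parity-free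
form of gen 31's `fibreMinU_eq_two_mul_tau1C_form` (`n = 2M + 1`). [cite: BalabanImbrieJaffe1985, (7.1.14) p.322] -/
theorem fibreMinU_eq_two_mul_tau1A_form (q : Tor N) {φ : Fin d × Fin d → ℂ} (hφ : ∀ μ ν, φ (ν, μ) = -φ (μ, ν)) :
    fibreMinU n N q φ = 2 * (tensorInner (fun μ ν => φ (μ, ν)) (tau1A n (sOf N q)) (fun μ ν => φ (μ, ν))).re := by
  rw [fibreMinU_eq_tOne n q hφ, tOne_eq_two_mul_tau1A_form n q hφ]

/-- The fibre `∂^{(1)}(p′) ∧ b` of a unit-lattice curl `∂B` at the unit momentum `p′` (`b = B̂(p′)`): the two-forms on which τ₁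
vanishes, (7.1.18). [cite: BalabanImbrieJaffe1985, (7.1.18) p.323] -/
def curlA (s : Fin d → ℝ) (b : Fin d → ℂ) : Fin d × Fin d → ℂ := fun a => dOne s a.1 * b a.2 - dOne s a.2 * b a.1

omit [NeZero n] in
/-- The curl fibre is a two-form. [cite: BalabanImbrieJaffe1985, (7.1.18) p.323] -/
theorem curlA_twoForm (s : Fin d → ℝ) (b : Fin d → ℂ) (μ ν : Fin d) : curlA s b (ν, μ) = -curlA s b (μ, ν) := by
  simp only [curlA]
  ring

omit [∀ μ, NeZero (N μ)] in
/-- **At every shift, `Q^{e*}_k` of the fibre of a unit-lattice curl is a fine curl**: with `φ = ∂^{(1)}(p′) ∧ b`,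
`w̄(p′+2πk) ⊙ φ = ∂(p′+2πk) ∧ (s̄(p′+2πk) ⊙ b)` (`s` = the Q^s-weight `surfW`) — p27 gen 2's `key_identity`, the fibre form of
`Q^{e*}_k∂ = ∂Q^{s*}_k` behind (7.1.18) *"Furthermore Q^{e*}_k∂ = ∂Q^{s*}_k, so τ₁∂ = Q^e_k(I − P_∂)∂Q^{s*}_k = 0. (7.1.18)"*, for EVERY `n`.
[cite: BalabanImbrieJaffe1985, (7.1.18) p.323] -/
theorem gA_curlA_eq (q : Tor N) (b : Fin d → ℂ) (k : Fin d → Fin n) :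
    (fun i : Fin d × Fin d => gA n (sOf N q) (curlA (sOf N q) b) k i.1 i.2) =
      fun i : Fin d × Fin d =>
        eA n (sOf N q) k i.1 * (conj (BIJ85Eq7116SurfaceAverage.surfW n k (sOf N q) i.2) * b i.2) -
          eA n (sOf N q) k i.2 * (conj (BIJ85Eq7116SurfaceAverage.surfW n k (sOf N q) i.1) * b i.1) := by
  have hkey : ∀ {l κ : Fin d}, l ≠ κ →
      dOne (sOf N q) l * conj (edgeW n k (sOf N q) l κ) =
        conj (BIJ85Eq7116SurfaceAverage.surfW n k (sOf N q) κ) * eA n (sOf N q) k l := by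
    intro l κ hlκ
    have h := congrArg conj (BIJ85Eq7118Intertwining.key_identity n N k q hlκ)
    rw [map_mul, map_mul, map_mul, Complex.conj_conj, Complex.conj_conj, Complex.conj_natCast] at h
    rw [dOne_eq_d1Sym, h]
    simp only [eA, B5Block118.dSym_eq_om]
    ring
  funext i
  simp only [gA, curlA]
  by_cases hi : i.1 = i.2
  · rw [hi]; ring
  · have h1 := hkey hi
    have h2 := hkey (Ne.symm hi)
    rw [edgeW_comm n k (sOf N q) i.2 i.1] at h2
    calc conj (edgeW n k (sOf N q) i.1 i.2) * (dOne (sOf N q) i.1 * b i.2 - dOne (sOf N q) i.2 * b i.1)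
        = (dOne (sOf N q) i.1 * conj (edgeW n k (sOf N q) i.1 i.2)) * b i.2 -
            (dOne (sOf N q) i.2 * conj (edgeW n k (sOf N q) i.1 i.2)) * b i.1 := by ring
      _ = _ := by rw [h1, h2]; ring

omit [∀ μ, NeZero (N μ)] in
/-- **`T₁ = 0` on the fibre of a curl** (every `n`, every `p′`): `(P⊗P)` kills the shift-wise curls (gen-31 `kron_projK_mulVec_curl`).
[cite: BalabanImbrieJaffe1985, (7.1.18) p.323] -/
theorem tOne_curlA (q : Tor N) (b : Fin d → ℂ) : tOne (eA n (sOf N q)) (gA n (sOf N q) (curlA (sOf N q) b)) = 0 := by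
  unfold tOne
  refine Finset.sum_eq_zero fun k _ => ?_
  have h := BIJ85Tau1ClosedCube.kron_projK_mulVec_curl (eA n (sOf N q) k)
    (fun κ => conj (BIJ85Eq7116SurfaceAverage.surfW n k (sOf N q) κ) * b κ)
  rw [gA_curlA_eq n q b k, h]
  simp

omit [∀ μ, NeZero (N μ)] in
/-- **`τ₁^A_n(p′)` VANISHES ON CURLS, FOR EVERY `n`** ((7.1.18) *"τ₁∂ = 0"* at symbol level over the complete residue system):
`m°_{p′}(∂^{(1)}(p′) ∧ b) = 0` and `⟨∂^{(1)} ∧ b, τ₁^A_n(p′)(∂^{(1)} ∧ b)⟩ = 0` at every dual momentum.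
[cite: BalabanImbrieJaffe1985, (7.1.18) p.323] -/
theorem tau1A_form_curlA (q : Tor N) (b : Fin d → ℂ) :
    fibreMinU n N q (curlA (sOf N q) b) = 0 ∧
      (tensorInner (fun μ ν => curlA (sOf N q) b (μ, ν)) (tau1A n (sOf N q)) (fun μ ν => curlA (sOf N q) b (μ, ν))).re = 0 := by
  have h1 := fibreMinU_eq_tOne n q (curlA_twoForm (sOf N q) b)
  have h2 := tOne_eq_two_mul_tau1A_form n q (curlA_twoForm (sOf N q) b)
  rw [tOne_curlA] at h1 h2
  exact ⟨h1, by linarith⟩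

end Free

/-! ## §4 At `p′ = 0`: the zero shift has `∂ = 0` and `r = 1`, so the constraint is free — `m_0 = m°_0`, `τ₂^A_n(0) = 0` -/

section Zero

variable (n : ℕ) [NeZero n] {N : Fin d → ℕ} [∀ μ, NeZero (N μ)]

/-- kernel: at `p′ = 0`, zero shift: `∂_μ(0) = 0`. [cite: BalabanImbrieJaffe1985, (7.1.4) p.322] -/
theorem eA_zero_zero (μ : Fin d) : eA n (0 : Fin d → ℝ) 0 μ = 0 := by
  show B5Prop11Fiber.dSym n 0 0 μ = 0
  unfold B5Prop11Fiber.dSym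
  have : shiftr n (0 : Fin d → Fin n) (0 : Fin d → ℝ) μ = 0 := by simp [B4Strip.shiftr]
  rw [this]
  simp

/-- kernel: at `p′ = 0`, zero shift: `u(0)v_μ(0) = 1` ([6I] p. 23 *"u_k(0) = 1"*). [cite: BalabanImbrieJaffe1985, (7.1.9) p.322] -/
theorem rA_zero_zero (μ : Fin d) : rA n (0 : Fin d → ℝ) 0 μ = 1 := by
  have hv : ∀ ρ, B5Prop11Fiber.vSym n 0 (0 : Fin d → ℝ) ρ = 1 := fun ρ => by
    have h0 : B5Prop11Fiber.dSym n 0 (0 : Fin d → ℝ) ρ = 0 := eA_zero_zero n ρ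
    unfold B5Prop11Fiber.vSym
    rw [if_pos h0]
  show B5Prop11Fiber.uSym n 0 0 * B5Prop11Fiber.vSym n 0 0 μ = 1
  rw [B5Prop11Fiber.uSym, hv, mul_one]
  exact Finset.prod_eq_one fun ρ _ => hv ρ

omit [∀ μ, NeZero (N μ)] in
/-- **`m_{p′}(φ) = m°_{p′}(φ)` at `p′ = 0`**: the constraint costs nothing there — any family is made constrained by changing it at the
zero shift only, where `∂(0) = 0` makes the energy blind (`τ₂(0) = 0`, cf. p10's `tau2C_zero`). [cite: BalabanImbrieJaffe1985, (7.1.16) p.323] -/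
theorem fibreMin_eq_fibreMinU_of_sOf_eq_zero (q : Tor N) (hq : sOf N q = 0) (φ : Fin d × Fin d → ℂ) :
    fibreMin n N q φ = fibreMinU n N q φ := by
  refine le_antisymm ((le_fibreMinU_iff n N).2 fun α => ?_) (fibreMinU_le_fibreMin n N q φ)
  -- repair α at the zero shift
  set β : (Fin d → Fin n) → Fin d → ℂ := fun k ν => if k = 0 then α 0 ν - ∑ k', rA n 0 k' ν * α k' ν else α k ν with hβ
  have hsplit : ∀ (ν : Fin d) (γ : (Fin d → Fin n) → Fin d → ℂ),
      ∑ k, rA n 0 k ν * γ k ν = rA n 0 0 ν * γ 0 ν + ∑ k ∈ Finset.univ.erase 0, rA n 0 k ν * γ k ν := fun ν γ =>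
    (Finset.add_sum_erase Finset.univ (fun k => rA n 0 k ν * γ k ν) (Finset.mem_univ 0)).symm
  have hcon : FibreConstraint n N q β := by
    rw [fibreConstraint_iff_constrL, hq]
    intro ν
    have h1 : ∑ k ∈ Finset.univ.erase 0, rA n 0 k ν * β k ν = ∑ k ∈ Finset.univ.erase 0, rA n 0 k ν * α k ν :=
      Finset.sum_congr rfl fun k hk => by rw [hβ]; simp only [if_neg (Finset.ne_of_mem_erase hk)]
    rw [hsplit ν β, h1, hβ]
    simp only [if_true, rA_zero_zero, one_mul]
    rw [hsplit ν α, rA_zero_zero, one_mul]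
    ring
  have hE : fibreEnergy n N q β φ = fibreEnergy n N q α φ := by
    rw [fibreEnergy_eq_energyL, fibreEnergy_eq_energyL, hq]
    unfold energyL
    refine Finset.sum_congr rfl fun k _ => ?_
    by_cases hk : k = 0
    · subst hk
      simp only [eA_zero_zero, zero_mul, sub_self, zero_sub]
    · simp only [hβ, if_neg hk]
  calc fibreMin n N q φ ≤ fibreEnergy n N q β φ := fibreMin_le n N hcon φ
    _ = fibreEnergy n N q α φ := hE

omit [NeZero n] in
/-- **`⟨φ, τ₂^A_n(0)φ⟩ = 0`**: `a^A(0) = 0` because `∂^{(1)}(0) = 0` (*"In the formula for τ₂, the averaging only occurs in a_μ(p′) =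
∂^{(1)}_μ(p′)Σ_l …"*). [cite: BalabanImbrieJaffe1985, (7.1.16) p.323] -/
theorem tau2A_form_zero (f : Fin d → Fin d → ℂ) : tensorInner f (tau2A n (0 : Fin d → ℝ)) f = 0 := by
  have ha : aA n (0 : Fin d → ℝ) = 0 := by
    funext μ
    rw [aA, Pi.zero_apply, dOne]
    simp
  have hh : hVec (0 : Fin d → ℂ) f = 0 := by
    funext κ
    simp [hVec]
  rw [tau2A, ha, tensorInner_tau2Kernel, hh, star_zero, zero_dotProduct]

end Zero

end

end Literature.MathematicalPhysics.QuantumFieldTheory.BalabanImbrieJaffe1984to88.BIJ85SigmaAllN
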